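import Literature.Probability.RandomPlanarGeometry.SLEBubblesProofs
import Literature.Probability.RandomPlanarGeometry.BrownianBubblesProofs
import Literature.Probability.RandomPlanarGeometry.RestrictionConfigEvents
import Literature.Probability.RandomPlanarGeometry.RestrictionMeasuresFiveEighths
import Mathlib.MeasureTheory.MeasurableSpace.CountablyGenerated
import Mathlib.MeasureTheory.Measure.WithDensity
import HarnessLib

/-!
# The bubble cloud exists by Kingman's theorem: `SLEBubbles.exists_cloud` from `exists_isPoissonCloud`

Second proof companion of `Literature.Probability.RandomPlanarGeometry.SLEBubbles` ([LSW] §7.2;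
the first, `SLEBubblesProofs`, is imported for the time measure `dt`), after

* G. F. Lawler, O. Schramm, W. Werner, *Conformal restriction: the chordal case*, J. Amer. Math.
  Soc. **16** (2003) 917–955, arXiv:math/0209343 (**[LSW]**), §7.2 (p. 28): "Consider a Poisson
  point process `X` on `Ω_b × [0, ∞)` with mean (intensity) `λ μ × dt`"; §7.1 (p. 27): the
  bubble measure is "a σ-finite but infinite measure";
* J. F. C. Kingman, *Poisson Processes* (1993), §2.5, Existence Theorem (the tree's named fact
  `Literature.Probability.Process.exists_isPoissonCloud`: a non-atomic s-finite measure on a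
  space with measurable diagonal is the mean measure of a Poisson process).

The named fact `SLEBubbles.exists_cloud` (for every Brownian bubble measure `μ` and every `κ`
there is a Poisson cloud with mean measure `λ_κ μ ⊗ dt`) is REDUCED to Kingman's theorem
(`Literature.Probability.RandomPlanarGeometry.SLEBubbles.exists_cloud_of_exists_isPoissonCloud`)
by PROVING its three hypotheses for the mean measure `λ_κ μ ⊗ dt` on `Ω_b × [0, ∞)`:

* **measurable diagonal** (`BubbleConfig.measurableSet_diagonal`, `measurableSet_diagonal_prod`):
  the avoidance σ-field of `Ω_b` ([LSW] §7.1 with §3 p. 10) is countably separated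
  (`BubbleConfig.countablySeparated`) — for bubbles `K ≠ K'`, say `z ∈ K ∖ K'`, some `*`-hull
  which is the half-plane fill of a finite union of dyadic squares contains `z` and is avoided by
  `K'` (`BubbleConfig.exists_dyadicUnion_isStarHull_hpFill`: join `z` inside the open connected
  set `ℍ ∖ K'` to a far point, drop a stick to the real axis, and take the dyadic squares of a
  fine generation along this compact connected set; `K'`, which accumulates only at `0`, escapes
  to infinity below the squares of the path and to the left of the stick, so it lies in the
  unbounded component of the complement and misses the fill) — hence embeds measurably into the
  Cantor space (`MeasurableSpace.measurable_injection_nat_bool_of_countablySeparated`);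
* **σ-finiteness** (`IsBrownianBubbleMeasure.sigmaFinite`): by (7.2) every hitting event
  `{K ∩ A ≠ ∅}`, `A ∈ 𝒬*`, has finite mass `−SΦ_A(0)/6` (restriction map and jet exist by the
  tree's `IsStarHull.existsUnique_isRestrictionMap_holds`, `IsStarHull.exists_hasRestrictionJet_holds`),
  and countably many of them cover `Ω_b` (`exists_countable_isStarHull_cover`: a countable family
  of `*`-hulls covers `ℍ`, and bubbles are nonempty subsets of `ℍ`);
* **no atoms** (`bubbleCloudIntensity_singleton`): `dt{t} = 0`.

Mathlib: `MeasurableSpace.CountablySeparated`, `measurableSet_eq_fun`,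
`MeasureTheory.Measure.sigmaFinite_of_countable`, `IsCompact.exists_cthickening_subset_open`,
`IsCompact.exists_isMinOn`, `JoinedIn.somePath`, `isPreconnected_of_forall`.
-/

noncomputable section

open Set Filter Topology MeasureTheory Metric Bornology
open UpperHalfPlane (upperHalfPlaneSet isOpen_upperHalfPlaneSet)
open scoped NNReal ENNReal
open Literature.Probability.Process (IsPoissonCloud exists_isPoissonCloud)

namespace Literature.Probability.RandomPlanarGeometry

namespace BubbleConfig

/-! ### Bubbles are relatively closed in `ℍ` -/

/-- `cl K ∩ ℍ = K` for a bubble `K` (`cl K = K ∪ {0}`). [folklore] -/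
theorem closure_inter_upperHalfPlaneSet (K : BubbleConfig) :
    closure (K : Set ℂ) ∩ upperHalfPlaneSet = K := by
  rw [K.closure_eq]
  ext z
  constructor
  · rintro ⟨hz | hz, hzH⟩
    · exact hz
    · rw [mem_singleton_iff] at hz
      have h : (0 : ℝ) < z.im := hzH
      rw [hz] at h
      simp at h
  · exact fun hz ↦ ⟨Or.inl hz, K.subset_upperHalfPlaneSet hz⟩

/-- `ℍ ∖ K` is open. [folklore] -/
theorem isOpen_diff (K : BubbleConfig) : IsOpen (upperHalfPlaneSet \ (K : Set ℂ)) := by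
  have h : upperHalfPlaneSet \ (K : Set ℂ) = upperHalfPlaneSet \ closure (K : Set ℂ) := by
    ext z
    constructor
    · rintro ⟨hzH, hzK⟩
      refine ⟨hzH, fun hcl ↦ hzK ?_⟩
      rw [← K.closure_inter_upperHalfPlaneSet]
      exact ⟨hcl, hzH⟩
    · rintro ⟨hzH, hzK⟩
      exact ⟨hzH, fun h ↦ hzK (subset_closure h)⟩
  rw [h]
  exact isOpen_upperHalfPlaneSet.sdiff isClosed_closure

/-- Points of `ℍ` off a bubble are off its closure. [folklore] -/
theorem notMem_closure {K : BubbleConfig} {z : ℂ} (hzH : z ∈ upperHalfPlaneSet) (hzK : z ∉ (K : Set ℂ)) :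
    z ∉ closure (K : Set ℂ) := fun h ↦ by
  rw [← K.closure_inter_upperHalfPlaneSet] at hzK
  exact hzK ⟨h, hzH⟩

/-! ### Separation of bubbles by dyadic `*`-hulls -/

/-- **A point of `ℍ` off a bubble lies in a `*`-hull avoided by the bubble, the fill of a finite
union of dyadic squares.** For `K ∈ Ω_b` and `z ∈ ℍ ∖ K`: join `z` to the far point
`w₀ = R + 2 + i` (`K ⊆ B̄(0, R)`) by a path in the open connected set `ℍ ∖ K` ([LSW] §7.1:
"`ℍ ∖ K` is connected"), continue by the stick `[R + 2, w₀]` down to the real axis, and take the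
dyadic squares of a fine generation meeting this compact connected set `C`: a compact `S ⊇ C`
attached to the lower half-plane, off `cl K = K ∪ {0}`, inside `{Im ≥ η/2} ∪ {Re ≥ R + 1}`
(`η = min Im` on the path). The connected set `K`, together with a half-disc at `0` and the
unbounded strip `{0 < Im < η/2, Re < R + 1}`, misses `S`, so it lies in the unbounded component
of `ℍ ∖ S`: `K` avoids `hpFill S`, and `0 ∉ hpFill S`, which is therefore a `*`-hull
(`isStarHull_hpFill`, Conway VIII.2.2 `isSimplyConnected_of_isConnected_compl_holds`). [folklore] -/
theorem exists_dyadicUnion_isStarHull_hpFill (K : BubbleConfig) {z : ℂ} (hzH : z ∈ upperHalfPlaneSet)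
    (hzK : z ∉ (K : Set ℂ)) :
    ∃ (n : ℕ) (F : Finset (ℤ × ℤ)), z ∈ dyadicUnion n F ∧
      IsStarHull (hpFill (dyadicUnion n F)) ∧ Disjoint (K : Set ℂ) (hpFill (dyadicUnion n F)) := by
  -- the open connected set `U = ℍ ∖ K` contains `z` and the far point `w₀`
  set U : Set ℂ := upperHalfPlaneSet \ (K : Set ℂ) with hU
  have hUo : IsOpen U := K.isOpen_diff
  have hUc : IsConnected U := K.isConnected_diff
  have hzU : z ∈ U := ⟨hzH, hzK⟩
  obtain ⟨R, hRpos, hR⟩ := K.isBounded.subset_closedBall_lt 0 0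
  set w₀ : ℂ := ((R + 2 : ℝ) : ℂ) + Complex.I with hw₀
  have hw₀re : w₀.re = R + 2 := by simp [hw₀]
  have hw₀im : w₀.im = 1 := by simp [hw₀]
  have hfar : ∀ w : ℂ, w.re = R + 2 → w ∉ closure (K : Set ℂ) := fun w hw hcl ↦ by
    rw [K.closure_eq] at hcl
    rcases hcl with h | h
    · have h1 := hR h
      rw [mem_closedBall, dist_zero_right] at h1
      have h2 := (Complex.re_le_norm w).trans h1
      rw [hw] at h2
      linarith
    · rw [mem_singleton_iff] at h
      rw [h, Complex.zero_re] at hw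
      linarith
  have hw₀U : w₀ ∈ U := by
    refine ⟨by rw [show w₀ ∈ upperHalfPlaneSet ↔ 0 < w₀.im from Iff.rfl, hw₀im]; exact one_pos,
      fun h ↦ hfar w₀ hw₀re (subset_closure h)⟩
  -- a path from `z` to `w₀` inside `U`, and the stick from `w₀` down to `R + 2`
  have hJ : JoinedIn U z w₀ := (hUo.isConnected_iff_isPathConnected.1 hUc).joinedIn z hzU _ hw₀U
  set π : Path z w₀ := hJ.somePath with hπ
  have hπU : ∀ t, π t ∈ U := hJ.somePath_mem
  set T : Set ℂ := (fun t : ℝ ↦ ((R + 2 : ℝ) : ℂ) + t * Complex.I) '' Icc 0 1 with hT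
  have hTre : ∀ w ∈ T, w.re = R + 2 := by
    rintro _ ⟨t, -, rfl⟩
    simp
  have hw₀T : w₀ ∈ T := ⟨1, ⟨zero_le_one, le_rfl⟩, by simp [hw₀]⟩
  have hfootT : (((R + 2 : ℝ) : ℂ)) ∈ T := ⟨0, ⟨le_rfl, zero_le_one⟩, by simp⟩
  set C₁ : Set ℂ := range π with hC₁
  set C : Set ℂ := C₁ ∪ T with hC
  have hC₁c : IsCompact C₁ := isCompact_range π.continuous
  have hTc : IsCompact T := isCompact_Icc.image (by fun_prop)
  have hCc : IsCompact C := hC₁c.union hTc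
  have hzC : z ∈ C := Or.inl ⟨0, π.source⟩
  -- `C` lies in the open set `O = (cl K)ᶜ`
  set O : Set ℂ := (closure (K : Set ℂ))ᶜ with hO
  have hOo : IsOpen O := isClosed_closure.isOpen_compl
  have hC₁U : C₁ ⊆ U := by
    rintro _ ⟨t, rfl⟩
    exact hπU t
  have hCO : C ⊆ O := by
    rintro w (hw | hw)
    · exact notMem_closure (hC₁U hw).1 (hC₁U hw).2
    · exact hfar w (hTre w hw)
  -- `C` is connected and attached to the real axis at `R + 2`
  have hC₁conn : IsConnected C₁ := isConnected_range π.continuous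
  have hTconn : IsConnected T := (isConnected_Icc zero_le_one).image _ (by fun_prop)
  have hCconn : IsConnected C := by
    refine IsConnected.union ⟨w₀, ⟨1, π.target⟩, hw₀T⟩ hC₁conn hTconn
  -- `η = min Im` on the path is positive
  obtain ⟨c₀, hc₀, hc₀min⟩ := hC₁c.exists_isMinOn (range_nonempty π) Complex.continuous_im.continuousOn
  set η : ℝ := c₀.im with hη
  have hηpos : 0 < η := (hC₁U hc₀).1
  have hηle : ∀ c ∈ C₁, η ≤ c.im := fun c hc ↦ hc₀min hc
  -- a fine generation `n`
  obtain ⟨δ, hδ, hδO⟩ := hCc.exists_cthickening_subset_open hOo hCO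
  set ε : ℝ := min δ (min (η / 2) 1) with hε
  have hεpos : 0 < ε := lt_min hδ (lt_min (half_pos hηpos) one_pos)
  have hεδ : ε ≤ δ := min_le_left _ _
  have hεη : ε ≤ η / 2 := (min_le_right _ _).trans (min_le_left _ _)
  have hε1 : ε ≤ 1 := (min_le_right _ _).trans (min_le_right _ _)
  obtain ⟨n, hn⟩ : ∃ n : ℕ, (2 : ℝ) / 2 ^ n ≤ ε := by
    obtain ⟨n, hn⟩ := exists_nat_gt (2 / ε)
    refine ⟨n, ?_⟩
    have h2n : (n : ℝ) < 2 ^ n := by exact_mod_cast Nat.lt_two_pow_self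
    have h2 : (0 : ℝ) < 2 ^ n := by positivity
    rw [div_le_iff₀ h2]
    rw [div_lt_iff₀ hεpos] at hn
    nlinarith
  -- the squares meeting `C`
  set F : Finset (ℤ × ℤ) := (finite_setOf_dyadicSquare_inter_nonempty hCc.isBounded n).toFinset with hF
  have hmemF : ∀ p : ℤ × ℤ, p ∈ F ↔ (dyadicSquare n p.1 p.2 ∩ C).Nonempty := fun p ↦ by
    rw [hF, Set.Finite.mem_toFinset]
    rfl
  set S : Set ℂ := dyadicUnion n F with hS
  -- `C ⊆ S ⊆ O`, and every point of `S` is within `ε` of `C`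
  have hCS : C ⊆ S := fun w hw ↦ by
    rw [hS, mem_dyadicUnion_iff]
    exact ⟨⟨_, _⟩, (hmemF _).2 ⟨w, mem_dyadicSquare_floor w n, hw⟩, mem_dyadicSquare_floor w n⟩
  have hnear : ∀ w ∈ S, ∃ c ∈ C, dist w c ≤ ε := fun w hw ↦ by
    rw [hS, mem_dyadicUnion_iff] at hw
    obtain ⟨p, hp, hwp⟩ := hw
    obtain ⟨c, hcp, hcC⟩ := (hmemF p).1 hp
    exact ⟨c, hcC, (dist_le_of_mem_dyadicSquare hwp hcp).trans hn⟩
  have hSO : S ⊆ O := fun w hw ↦ by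
    obtain ⟨c, hcC, hwc⟩ := hnear w hw
    exact hδO (mem_cthickening_of_dist_le w c δ C hcC (hwc.trans hεδ))
  -- points of `S` are high (near the path) or far to the right (near the stick)
  have hSloc : ∀ w ∈ S, η / 2 ≤ w.im ∨ R + 1 ≤ w.re := fun w hw ↦ by
    obtain ⟨c, hcC, hwc⟩ := hnear w hw
    rw [dist_eq_norm] at hwc
    rcases hcC with hc | hc
    · left
      have h1 := (Complex.abs_im_le_norm (w - c)).trans hwc
      rw [Complex.sub_im, abs_le] at h1
      linarith [hηle c hc, h1.1]
    · right
      have h1 := (Complex.abs_re_le_norm (w - c)).trans hwc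
      rw [Complex.sub_re, abs_le, hTre c hc] at h1
      linarith [h1.1]
  have hKS : Disjoint (K : Set ℂ) S :=
    Set.disjoint_left.2 fun w hwK hwS ↦ hSO hwS (subset_closure hwK)
  have h0S : (0 : ℂ) ∉ S := fun h ↦ hSO h K.zero_mem_closure
  have hSclosed : IsClosed S := isClosed_dyadicUnion
  have hSb : IsBounded S := isBounded_dyadicUnion
  -- `S ∪ {Im ≤ 0}` is connected: every square meets the connected set `C ∪ {Im ≤ 0} ∋ R + 2`
  have hconn : IsConnected (S ∪ {w : ℂ | w.im ≤ 0}) := by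
    have hfoot0 : (((R + 2 : ℝ) : ℂ)) ∈ {w : ℂ | w.im ≤ 0} := by simp
    have hD : IsPreconnected (C ∪ {w : ℂ | w.im ≤ 0}) :=
      (hCconn.union ⟨((R + 2 : ℝ) : ℂ), Or.inr hfootT, hfoot0⟩
        ((convex_halfSpace_im_le 0).isConnected ⟨0, by simp⟩)).isPreconnected
    have hDsub : C ∪ {w : ℂ | w.im ≤ 0} ⊆ S ∪ {w : ℂ | w.im ≤ 0} := union_subset_union_left _ hCS
    refine ⟨⟨_, Or.inl (hCS (Or.inr hfootT))⟩, isPreconnected_of_forall (((R + 2 : ℝ) : ℂ)) ?_⟩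
    rintro y (hy | hy)
    · rw [hS, mem_dyadicUnion_iff] at hy
      obtain ⟨p, hp, hyp⟩ := hy
      obtain ⟨c, hcp, hcC⟩ := (hmemF p).1 hp
      refine ⟨dyadicSquare n p.1 p.2 ∪ (C ∪ {w : ℂ | w.im ≤ 0}), ?_, Or.inr (Or.inl (Or.inr hfootT)),
        Or.inl hyp, ?_⟩
      · refine union_subset (fun w hw ↦ Or.inl ?_) hDsub
        rw [hS, mem_dyadicUnion_iff]
        exact ⟨p, hp, hw⟩
      · exact IsPreconnected.union c hcp (Or.inl hcC) convex_dyadicSquare.isPreconnected hD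
    · exact ⟨C ∪ {w : ℂ | w.im ≤ 0}, hDsub, Or.inl (Or.inr hfootT), Or.inr hy, hD⟩
  -- `K`, a half-disc at `0` and the strip `L` lie in the unbounded component `V` of `ℍ ∖ S`
  set V : Set ℂ := Loewner.unboundedComponent (upperHalfPlaneSet \ S) with hV
  obtain ⟨ρ, hρ, hρS⟩ : ∃ ρ > 0, ball (0 : ℂ) ρ ⊆ Sᶜ :=
    Metric.isOpen_iff.1 hSclosed.isOpen_compl 0 h0S
  set W : Set ℂ := ball (0 : ℂ) ρ ∩ upperHalfPlaneSet with hW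
  set L : Set ℂ := {w : ℂ | 0 < w.im ∧ w.im < η / 2 ∧ w.re < R + 1} with hL
  obtain ⟨k, hkK, hkρ⟩ : ((K : Set ℂ) ∩ ball 0 ρ).Nonempty := by
    have := K.zero_mem_closure
    rw [_root_.mem_closure_iff] at this
    obtain ⟨k, hk1, hk2⟩ := this (ball 0 ρ) isOpen_ball (mem_ball_self hρ)
    exact ⟨k, hk2, hk1⟩
  -- a common point of `W` and `L`
  set t₀ : ℝ := min ρ (η / 2) / 2 with ht₀
  have ht₀pos : 0 < t₀ := by positivity
  have ht₀ρ : t₀ < ρ := by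
    have : min ρ (η / 2) ≤ ρ := min_le_left _ _
    rw [ht₀]; linarith
  have ht₀η : t₀ < η / 2 := by
    have : min ρ (η / 2) ≤ η / 2 := min_le_right _ _
    rw [ht₀]; linarith
  set q₀ : ℂ := (t₀ : ℂ) * Complex.I with hq₀
  have hq₀im : q₀.im = t₀ := by simp [hq₀]
  have hq₀re : q₀.re = 0 := by simp [hq₀]
  have hq₀W : q₀ ∈ W := by
    refine ⟨?_, by rw [show q₀ ∈ upperHalfPlaneSet ↔ 0 < q₀.im from Iff.rfl, hq₀im]; exact ht₀pos⟩
    rw [mem_ball, dist_zero_right]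
    have : ‖q₀‖ = t₀ := by
      rw [hq₀, norm_mul, Complex.norm_I, mul_one, Complex.norm_real, Real.norm_eq_abs, abs_of_pos ht₀pos]
    rw [this]
    exact ht₀ρ
  have hq₀L : q₀ ∈ L := by
    refine ⟨by rw [hq₀im]; exact ht₀pos, by rw [hq₀im]; exact ht₀η, by rw [hq₀re]; linarith⟩
  have hLconv : Convex ℝ L := by
    have h1 : Convex ℝ {w : ℂ | 0 < w.im} := convex_halfSpace_im_gt 0
    have h2 : Convex ℝ {w : ℂ | w.im < η / 2} := convex_halfSpace_im_lt _
    have h3 : Convex ℝ {w : ℂ | w.re < R + 1} := convex_halfSpace_re_lt _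
    have : L = {w : ℂ | 0 < w.im} ∩ ({w : ℂ | w.im < η / 2} ∩ {w : ℂ | w.re < R + 1}) := by
      ext w; simp [hL]
    rw [this]
    exact h1.inter (h2.inter h3)
  have hLS : Disjoint L S := Set.disjoint_left.2 fun w hwL hwS ↦ by
    rcases hSloc w hwS with h | h
    · exact absurd hwL.2.1 (not_lt.2 h)
    · exact absurd hwL.2.2 (not_lt.2 h)
  have hLunb : ¬ IsBounded L := by
    intro hb
    obtain ⟨R', hR'pos, hR'⟩ := hb.subset_closedBall_lt 0 0
    set w : ℂ := ((-(R' + 1) : ℝ) : ℂ) + (t₀ : ℂ) * Complex.I with hw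
    have hwL : w ∈ L := by
      refine ⟨by simp [hw, ht₀pos], by simpa [hw] using ht₀η, ?_⟩
      simp [hw]
      linarith
    have h1 := hR' hwL
    rw [mem_closedBall, dist_zero_right] at h1
    have h2 := (Complex.abs_re_le_norm w).trans h1
    simp [hw] at h2
    rw [abs_of_neg (by linarith)] at h2
    linarith
  have hTV : (W ∪ L) ∪ (K : Set ℂ) ⊆ V := by
    refine subset_unboundedComponent_of_isPreconnected ?_ ?_ ?_
    · refine IsPreconnected.union k (Or.inl ⟨hkρ, K.subset_upperHalfPlaneSet hkK⟩) hkK ?_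
        K.isConnected.isPreconnected
      exact IsPreconnected.union q₀ hq₀W hq₀L
        ((convex_ball (0 : ℂ) ρ).inter (convex_halfSpace_im_gt 0)).isPreconnected hLconv.isPreconnected
    · rintro w ((⟨hwρ, hwH⟩ | hwL) | hwK)
      · exact ⟨hwH, fun hwS ↦ hρS hwρ hwS⟩
      · exact ⟨hwL.1, fun hwS ↦ Set.disjoint_left.1 hLS hwL hwS⟩
      · exact ⟨K.subset_upperHalfPlaneSet hwK, Set.disjoint_left.1 hKS hwK⟩
    · exact fun hb ↦ hLunb (hb.subset (subset_union_right.trans subset_union_left))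
  -- hence `0 ∉ hpFill S = cl (ℍ ∖ V)`
  have h0 : (0 : ℂ) ∉ hpFill S := by
    intro h0
    change (0 : ℂ) ∈ closure (upperHalfPlaneSet \ V) at h0
    rw [_root_.mem_closure_iff] at h0
    obtain ⟨u, huρ, huH, huV⟩ := h0 (ball 0 ρ) isOpen_ball (mem_ball_self hρ)
    exact huV (hTV (Or.inl (Or.inl ⟨huρ, huH⟩)))
  refine ⟨n, F, hCS hzC,
    isStarHull_hpFill isSimplyConnected_of_isConnected_compl_holds hSclosed hSb hconn h0, ?_⟩
  -- and `K ⊆ V` misses `hpFill S`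
  refine Set.disjoint_left.2 fun w hwK hwF ↦ ?_
  have : w ∈ hpFill S ∩ upperHalfPlaneSet := ⟨hwF, K.subset_upperHalfPlaneSet hwK⟩
  rw [hpFill_inter hSclosed hSb] at this
  exact this.2 (hTV (Or.inr hwK))

/-! ### The avoidance σ-field of `Ω_b` is countably separated; its diagonal is measurable -/

open Classical in
/-- **The avoidance σ-field of `Ω_b` separates points countably**: the hitting events of the
`*`-hulls which are fills of finite unions of dyadic squares (a countable family of measurable
sets) distinguish any two bubbles (`exists_dyadicUnion_isStarHull_hpFill`). [folklore] -/
theorem countablySeparated : MeasurableSpace.CountablySeparated BubbleConfig := by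
  -- the separating family, indexed by `ℕ × Finset (ℤ × ℤ)` (`∅` when the fill is not a `*`-hull)
  set f : ℕ × Finset (ℤ × ℤ) → Set BubbleConfig := fun nF ↦
    if IsStarHull (hpFill (dyadicUnion nF.1 nF.2)) then hit (hpFill (dyadicUnion nF.1 nF.2)) else ∅
    with hf
  have hfmeas : ∀ nF, MeasurableSet (f nF) := fun nF ↦ by
    simp only [hf]
    split_ifs with h
    · exact measurableSet_hit h
    · exact MeasurableSet.empty
  refine ⟨⟨range f, countable_range _, ?_, fun K _ K' _ h ↦ ?_⟩⟩
  · rintro _ ⟨nF, rfl⟩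
    exact hfmeas nF
  · -- if `K ≠ K'` some dyadic hull is hit by exactly one of them
    have key : ∀ K K' : BubbleConfig, (∀ s ∈ range f, K ∈ s ↔ K' ∈ s) → (K : Set ℂ) ⊆ K' := by
      intro K K' hKK' w hwK
      by_contra hwK'
      obtain ⟨n, F, hwS, hstar, hdisj⟩ :=
        K'.exists_dyadicUnion_isStarHull_hpFill (K.subset_upperHalfPlaneSet hwK) hwK'
      have hs : f (n, F) = hit (hpFill (dyadicUnion n F)) := if_pos hstar
      have h1 : K ∈ f (n, F) := by
        rw [hs, mem_hit]
        exact fun hd ↦ Set.disjoint_left.1 hd hwK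
          (inter_subset_hpFill _ ⟨hwS, K.subset_upperHalfPlaneSet hwK⟩)
      have h2 : K' ∉ f (n, F) := by
        rw [hs, mem_hit, not_not]
        exact hdisj
      exact h2 ((hKK' _ ⟨(n, F), rfl⟩).1 h1)
    exact Subtype.ext (Subset.antisymm (key K K' h) (key K' K fun s hs ↦ (h s hs).symm))

/-- **The diagonal of `Ω_b × Ω_b` is measurable** (a countably separated space embeds measurably
into the Cantor space `ℕ → Bool`). [folklore] -/
theorem measurableSet_diagonal : MeasurableSet (Set.diagonal BubbleConfig) := by
  haveI := countablySeparated
  obtain ⟨f, hf, hinj⟩ := MeasurableSpace.measurable_injection_nat_bool_of_countablySeparated BubbleConfig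
  have h : Set.diagonal BubbleConfig = ⋂ n, {p : BubbleConfig × BubbleConfig | f p.1 n = f p.2 n} := by
    ext ⟨K, K'⟩
    simp only [mem_diagonal_iff, mem_iInter, mem_setOf_eq]
    exact ⟨fun h n ↦ by rw [h], fun h ↦ hinj (funext h)⟩
  rw [h]
  refine MeasurableSet.iInter fun n ↦ measurableSet_eq_fun ?_ ?_
  · exact (measurable_pi_apply n).comp (hf.comp measurable_fst)
  · exact (measurable_pi_apply n).comp (hf.comp measurable_snd)

end BubbleConfig

/-- **The diagonal of the state space `Ω_b × [0, ∞)` of the bubble cloud is measurable.** [folklore] -/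
theorem measurableSet_diagonal_prod : MeasurableSet (Set.diagonal (BubbleConfig × ℝ≥0)) := by
  have h : Set.diagonal (BubbleConfig × ℝ≥0) =
      (fun p : (BubbleConfig × ℝ≥0) × (BubbleConfig × ℝ≥0) ↦ (p.1.1, p.2.1)) ⁻¹' Set.diagonal BubbleConfig ∩
        (fun p : (BubbleConfig × ℝ≥0) × (BubbleConfig × ℝ≥0) ↦ (p.1.2, p.2.2)) ⁻¹' Set.diagonal ℝ≥0 := by
    ext ⟨⟨K, t⟩, ⟨K', t'⟩⟩
    simp [Prod.ext_iff]
  rw [h]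
  exact (BubbleConfig.measurableSet_diagonal.preimage (by fun_prop)).inter
    ((measurableSet_diagonal : MeasurableSet (Set.diagonal ℝ≥0)).preimage (by fun_prop))

/-! ### Brownian bubble measures are σ-finite ([LSW] §7.1) -/

/-- **A Brownian bubble measure is σ-finite** ([LSW] §7.1, p. 27: "a σ-finite but infinite
measure"): by (7.2) each hitting event `{K ∩ A ≠ ∅}`, `A ∈ 𝒬*`, has the finite mass
`−SΦ_A(0)/6`, and the hitting events of a countable family of `*`-hulls covering `ℍ`
(`exists_countable_isStarHull_cover`) cover `Ω_b`, bubbles being nonempty subsets of `ℍ`.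
[cite: LawlerSchrammWerner2003Restriction, §7.1 (p. 27)] -/
theorem IsBrownianBubbleMeasure.sigmaFinite {μ : Measure BubbleConfig} (hμ : IsBrownianBubbleMeasure μ) :
    SigmaFinite μ := by
  obtain ⟨𝓕, h𝓕c, h𝓕star, hcover⟩ := exists_countable_isStarHull_cover
  refine Measure.sigmaFinite_of_countable (h𝓕c.image BubbleConfig.hit) ?_ ?_
  · rintro _ ⟨A, hA, rfl⟩
    obtain ⟨Φ, hΦ, -⟩ := IsStarHull.existsUnique_isRestrictionMap_holds (h𝓕star A hA)
    obtain ⟨d, c₂, c₃, hJ⟩ := IsStarHull.exists_hasRestrictionJet_holds (h𝓕star A hA) hΦ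
    rw [hμ (h𝓕star A hA) hΦ hJ]
    exact ENNReal.ofReal_lt_top
  · refine eq_univ_of_forall fun K ↦ ?_
    obtain ⟨k, hk⟩ := K.nonempty
    obtain ⟨A, hA, hkA⟩ := hcover (K.subset_upperHalfPlaneSet hk)
    exact ⟨_, ⟨A, hA, rfl⟩, fun hdis ↦ Set.disjoint_left.1 hdis hk hkA⟩

/-! ### The mean measure `λ_κ μ ⊗ dt` has no atoms and is s-finite -/

/-- `dt{t} = 0`. [folklore] -/
theorem timeMeasure_singleton (t : ℝ≥0) : timeMeasure {t} = 0 := by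
  rw [timeMeasure, Measure.map_apply measurable_real_toNNReal (measurableSet_singleton t),
    Measure.restrict_apply (measurable_real_toNNReal (measurableSet_singleton t))]
  refine measure_mono_null (t := {(t : ℝ)}) ?_ Real.volume_singleton
  rintro x ⟨hx, hx0⟩
  rw [mem_preimage, mem_singleton_iff] at hx
  rw [mem_singleton_iff, ← hx, Real.coe_toNNReal _ hx0]

/-- **The mean measure of the bubble cloud has no atoms** (`dt{t} = 0`). [folklore] -/
theorem bubbleCloudIntensity_singleton (κ : ℝ≥0) (μ : Measure BubbleConfig) (x : BubbleConfig × ℝ≥0) :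
    bubbleCloudIntensity κ μ {x} = 0 := by
  obtain ⟨K, t⟩ := x
  rw [bubbleCloudIntensity, Measure.smul_apply, ← singleton_prod_singleton, Measure.prod_prod,
    timeMeasure_singleton, mul_zero, smul_zero]

/-- The mean measure of the bubble cloud is s-finite for a σ-finite `μ`. [folklore] -/
theorem sFinite_bubbleCloudIntensity (κ : ℝ≥0) (μ : Measure BubbleConfig) [SigmaFinite μ] :
    SFinite (bubbleCloudIntensity κ μ) := by
  unfold bubbleCloudIntensity timeMeasure
  infer_instance

/-! ### `SLEBubbles.exists_cloud` from Kingman's existence theorem -/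

/-- **The bubble cloud exists, by Kingman's existence theorem** ([LSW] §7.2, p. 28: "Consider a
Poisson point process `X` on `Ω_b × [0, ∞)` with mean (intensity) `λ μ × dt`"; Kingman 1993,
§2.5): the named fact `SLEBubbles.exists_cloud` follows from
`Literature.Probability.Process.exists_isPoissonCloud`, whose hypotheses hold for `λ_κ μ ⊗ dt`
— measurable diagonal (`measurableSet_diagonal_prod`), s-finiteness (`μ` is σ-finite,
`IsBrownianBubbleMeasure.sigmaFinite`) and no atoms (`bubbleCloudIntensity_singleton`).
[cite: LawlerSchrammWerner2003Restriction, §7.2 (p. 28) with §7.1 (p. 27)] -/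
theorem SLEBubbles.exists_cloud_of_exists_isPoissonCloud (h : exists_isPoissonCloud.{0}) :
    SLEBubbles.exists_cloud := by
  intro μ hμ κ
  haveI := hμ.sigmaFinite
  exact h (bubbleCloudIntensity κ μ) measurableSet_diagonal_prod (sFinite_bubbleCloudIntensity κ μ)
    (bubbleCloudIntensity_singleton κ μ)

end Literature.Probability.RandomPlanarGeometry

end
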